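import Literature.AlgebraicGeometry.ComplexMultiplication.CyclotomicFermatCMTypesKoblitzListLevelPrimePowers
import HarnessLib

/-!
# Koblitz's list at an ARBITRARY level, IV: for EVERY level `n` and EVERY admissible triple with `H_{r,s,t}` a group, the reduced level
# `n₀ = n/gcd(r,s,t)` is bounded — `n₀ ≤ (2⁶⁵)^(2⁶⁵)` — i.e. «`n₀` belongs to a finite set», and the same on abelian varieties

Layer `Literature/AlgebraicGeometry/ComplexMultiplication`, namespace `…ComplexMultiplication.CyclotomicFermatCMType`; sequel of
`CyclotomicFermatCMTypesKoblitzListLevelPrimePowers` (this lane gen 44: a PRIMITIVE admissible triple with `H` closed has level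
`N ≤ (2⁶⁵)^(2⁶⁵)`) and `CyclotomicFermatCMTypesKoblitzListLevelReduction` (gen 42: `H_{r,s,t}` at level `n` is a group iff the reduced primitive
triple's `H` at level `n₀` is).  THEOREMS ONLY (no definition, no named fact, no `sorry`).

THE SOURCES (held, read first-hand).  M. Bauer, A. Coste, C. Itzykson, P. Ruelle, J. Geom. Phys. **22** (1997) §3.4 p. 14 (held
`paper:arxiv-hep-th_9604104`): «Setting `gcd(r,s,t) = n/n₀` as above, he finds that no `L_{r,s,t}` is isogenous to a product of elliptic factors
unless `n₀` belongs to the following set `{3, 4, 6, 7, 8, 12, 15, 16, 18, 20, 21, 22, 24, 30, 39, 40, 48, 60}` [kob]» ([kob] = N. Koblitz, Duke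
Math. J. **45** (1978) 87–99, NOT held, acq-13447).  N. Koblitz, D. Rohrlich, Canad. J. Math. **30** (1978) §1 p. 1184, §2 p. 1187.

THE POINT.  The tree held the printed sentence in the form «`H` closed ⟹ `n₀ ∈` the printed set ∨ `n₀ > 72`» (census `n₀ ≤ 72`, gen 42),
with the disjunct `n₀ > 72` = [kob] proper, sharpened by gen 43 to the mixed levels.  The prequel's level bound now makes the tail FINITE:
for every level `n` and every admissible normalised pair `(r, s)` with `H_{r,s,−r−s}` a group, **`n₀ ∈ {3, …, 60}` (printed) or
`72 < n₀ ≤ (2⁶⁵)^(2⁶⁵)`** — Koblitz's qualitative theorem «`n₀` belongs to a finite set» is a theorem of the tree (our proof: the odd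
quadratic character of `H`, K–R's display through the conductor, `|B_{1,χ}| ≤ π⁻¹√f log f`, integrality and the half-sum bound), with the
identification of that finite set beyond `72` left to [kob]'s census.

## What is proved (namespace `…CyclotomicFermatCMType`)

* **`n0_le_of_forall_mul_mem`** — EVERY level `n`, every admissible normalised pair with `H` closed: `n₀ = n/gcd(gcd(⟨r⟩,⟨s⟩), n) ≤ (2⁶⁵)^(2⁶⁵)`.
* **`n0_mem_koblitzList_or_of_forall_mul_mem_finite`** — `n₀ ∈` the printed set ∨ (`72 < n₀ ∧ n₀ ≤ (2⁶⁵)^(2⁶⁵)`).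
* **`n0_le_of_exists_isIsogeny_pow_elliptic`**, **`n0_mem_koblitzList_or_of_exists_isIsogeny_pow_elliptic_finite`** — the same for any
  realisation `A` of the K–R type `Φ_{H_{r,s,−r−s}}` isogenous to a power of an elliptic curve.

## Honest column / NOT here

* The bound is absurd and the census `72 < n₀ ≤ (2⁶⁵)^(2⁶⁵)` is not attempted; the printed list itself remains CITE [kob] beyond the families
  settled by gens 42–43 (prime to `6`, prime powers, `3`-smooth, `{3,7}`, `{3,13}`, `−1` a square, `2pᵏ/4pᵏ/3ᵃpᵇ/pᵃqᵇ` sub-families).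
* `J(F_n)` is not constructed; statements are about the K–R factor types and all their realisations.  HC_CM is NOT proved and nothing here
  bears on it.

## References

* [BauerCosteItzyksonRuelle1997] M. Bauer, A. Coste, C. Itzykson, P. Ruelle, J. Geom. Phys. 22 (1997) 134–189, §3.4 (p. 14).
* [KoblitzRohrlich1978] N. Koblitz, D. Rohrlich, Canad. J. Math. 30 (1978) 1183–1205, §1 (pp. 1183–1184), §2 (p. 1187).
* [kob] N. Koblitz, Duke Math. J. 45 (1978) 87–99 — cited for the statement of the list only; not held, not used.

## Provenance

Cell `pub-hodgecm2` (COR-CM), literature seat `lit-deligne-3` gen 44 (claim KOBLITZ-FINITENESS; count-neutral, own lane).  HC_CM is NOT proved and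
nothing here bears on it.
-/

noncomputable section

open NumberField

namespace Literature.AlgebraicGeometry.ComplexMultiplication

open CategoryTheory CategoryTheory.Limits
open Literature.AlgebraicGeometry.Motives (CMType AbelianVariety)
open Literature.AlgebraicGeometry.Motives.AbelianVariety
open Literature.NumberTheory.ComplexMultiplication
open Literature.AlgebraicGeometry.HodgeTheory
open Literature.AlgebraicGeometry.Pohlmann1968 Literature.AlgebraicGeometry.Pohlmann1968.Cyclotomic
open CyclotomicCMTypeResidueSets (IsCMResidueSet unitResidues residueSet residueSet_cmTypeOfResidues isCMResidueSet_residueSet)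

namespace CyclotomicFermatCMType

/-! ## §1 Every level: `n₀ ≤ (2⁶⁵)^(2⁶⁵)` -/

section AllLevels

/-- **KOBLITZ'S FINITENESS FOR EVERY TRIPLE AT EVERY LEVEL**: for every admissible normalised pair `(r, s)` modulo `n` (`r, s ≠ 0`,
`⟨r⟩ + ⟨s⟩ < n`; no primitivity, no bound on `n`) whose `H_{r,s,−r−s}` is closed under multiplication, the reduced level
`n₀ = n / gcd(gcd(⟨r⟩,⟨s⟩), n)` satisfies `n₀ ≤ (2⁶⁵)^(2⁶⁵)` — by the reduction to the primitive triple of level `n₀` (K–R: «we may assume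
g.c.d.`(N, r, s, t) = 1`, whence `M = N`») and the prequel's level bound. [cite: BauerCosteItzyksonRuelle1997, §3.4 (p. 14)]
[cite: KoblitzRohrlich1978, §1 (pp. 1183–1184), §2 (p. 1187)] -/
theorem n0_le_of_forall_mul_mem (n : ℕ) [NeZero n] {r s : ZMod n} (hr : r ≠ 0) (hs : s ≠ 0) (hrs : r.val + s.val < n)
    (hcl : ∀ a ∈ fermatCMType n r s (-(r + s)), ∀ b ∈ fermatCMType n r s (-(r + s)), a * b ∈ fermatCMType n r s (-(r + s))) :
    n / Nat.gcd (Nat.gcd r.val s.val) n ≤ (2 ^ 65) ^ (2 ^ 65) := by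
  obtain ⟨g, m, r₁, s₁, hg, hn, hm, hr1, hs1, hr0, hs0, hlt, h3, hprim⟩ := exists_reduced_primitive hr hs hrs
  rw [hm]
  haveI : NeZero m := ⟨by omega⟩
  have hcl' := (forall_mul_mem_iff_reduced hn hg hr1 hs1 hr0 hlt).1 hcl
  have hr1v : ((r₁ : ℕ) : ZMod m).val = r₁ := by rw [ZMod.val_natCast, Nat.mod_eq_of_lt (by omega)]
  have hs1v : ((s₁ : ℕ) : ZMod m).val = s₁ := by rw [ZMod.val_natCast, Nat.mod_eq_of_lt (by omega)]
  have hr' : ((r₁ : ℕ) : ZMod m) ≠ 0 := fun h => by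
    have h1 := (ZMod.val_eq_zero _).2 h
    rw [hr1v] at h1
    omega
  have hs' : ((s₁ : ℕ) : ZMod m) ≠ 0 := fun h => by
    have h1 := (ZMod.val_eq_zero _).2 h
    rw [hs1v] at h1
    omega
  have hlt' : ((r₁ : ℕ) : ZMod m).val + ((s₁ : ℕ) : ZMod m).val < m := by rw [hr1v, hs1v]; exact hlt
  have hprim' : Nat.gcd (Nat.gcd ((r₁ : ℕ) : ZMod m).val ((s₁ : ℕ) : ZMod m).val) m = 1 := by rw [hr1v, hs1v]; exact hprim
  exact level_le_of_forall_mul_mem hr' hs' hlt' hprim' hcl'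

/-- **THE PRINTED SENTENCE WITH A FINITE TAIL**: for every admissible normalised triple at every level `n` with `H` closed under
multiplication, `n₀ ∈ {3, 4, 6, 7, 8, 12, 15, 16, 18, 20, 21, 22, 24, 30, 39, 40, 48, 60}` (the printed set, by the census `n₀ ≤ 72`) OR
`72 < n₀ ≤ (2⁶⁵)^(2⁶⁵)` (finitely many further candidates; their exclusion is [kob]). [cite: BauerCosteItzyksonRuelle1997, §3.4 (p. 14)]
[cite: KoblitzRohrlich1978, §1 (pp. 1183–1184), §2 (p. 1187)] -/
theorem n0_mem_koblitzList_or_of_forall_mul_mem_finite (n : ℕ) [NeZero n] {r s : ZMod n} (hr : r ≠ 0) (hs : s ≠ 0)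
    (hrs : r.val + s.val < n)
    (hcl : ∀ a ∈ fermatCMType n r s (-(r + s)), ∀ b ∈ fermatCMType n r s (-(r + s)), a * b ∈ fermatCMType n r s (-(r + s))) :
    n / Nat.gcd (Nat.gcd r.val s.val) n ∈ ({3, 4, 6, 7, 8, 12, 15, 16, 18, 20, 21, 22, 24, 30, 39, 40, 48, 60} : Finset ℕ) ∨
      (72 < n / Nat.gcd (Nat.gcd r.val s.val) n ∧ n / Nat.gcd (Nat.gcd r.val s.val) n ≤ (2 ^ 65) ^ (2 ^ 65)) := by
  rcases n0_mem_koblitzList_or_lt_of_forall_mul_mem n hr hs hrs hcl with h | h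
  · exact Or.inl h
  · exact Or.inr ⟨h, n0_le_of_forall_mul_mem n hr hs hrs hcl⟩

variable {n : ℕ} [NeZero n] {L : Type} [Field L] [NumberField L] [IsCyclotomicExtension {n} ℚ L]

/-- **«No `L_{r,s,t}` is isogenous to a product of elliptic factors unless `n₀` belongs to a FINITE set» ON ABELIAN VARIETIES, AT EVERY
LEVEL `n`**: for every admissible normalised triple modulo `n` and any realisation `A` of the K–R type `Φ_{H_{r,s,−r−s}}` of `ℚ(ζ_n)`: if `A` is
isogenous to a power of an elliptic curve then `n₀ ≤ (2⁶⁵)^(2⁶⁵)`. [cite: BauerCosteItzyksonRuelle1997, §3.4 (p. 14)]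
[cite: KoblitzRohrlich1978, §1 (p. 1184)] -/
theorem n0_le_of_exists_isIsogeny_pow_elliptic {r s : ZMod n} (hr : r ≠ 0) (hs : s ≠ 0) (hrs : r.val + s.val < n)
    {hS : ∀ c : ZMod n, c.val.Coprime n → (c ∈ fermatCMType n r s (-(r + s)) ↔ -c ∉ fermatCMType n r s (-(r + s)))}
    {A : AbelianVariety ℂ} {ι : 𝓞 L →+* End A} {θ : L →+* Module.End ℂ (complexBetti A.X 1)}
    (hA : IsCMTypeRealisation (cmTypeOfResidues (L := L) (fermatCMType n r s (-(r + s))) hS) A ι θ)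
    (hE : ∃ (E P : AbelianVariety ℂ) (h : ℕ) (π : Fin h → (P ⟶ E)) (g : A ⟶ P),
      E.dim = 1 ∧ Nonempty (IsLimit (Fan.mk P π)) ∧ IsIsogeny g) :
    n / Nat.gcd (Nat.gcd r.val s.val) n ≤ (2 ^ 65) ^ (2 ^ 65) := by
  have hrv : 0 < r.val := Nat.pos_of_ne_zero fun h => hr ((ZMod.val_eq_zero r).1 h)
  have hsv : 0 < s.val := Nat.pos_of_ne_zero fun h => hs ((ZMod.val_eq_zero s).1 h)
  have hn2 : 2 < n := by omega
  haveI : IsCMField L := IsCyclotomicExtension.Rat.isCMField L (S := {n}) ⟨n, rfl, hn2⟩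
  have hcl := (exists_isIsogeny_pow_elliptic_fermat_iff_forall_mul_mem hn2 (one_mem_fermatCMType_of_val_add_lt hr hrs) hA).1 hE
  exact n0_le_of_forall_mul_mem n hr hs hrs hcl

/-- **The printed sentence with a finite tail, on abelian varieties**: `A` (realising `Φ_{H_{r,s,−r−s}}`) isogenous to a power of an elliptic
curve ⟹ `n₀ ∈` the printed set ∨ (`72 < n₀ ≤ (2⁶⁵)^(2⁶⁵)`). [cite: BauerCosteItzyksonRuelle1997, §3.4 (p. 14)] [cite: KoblitzRohrlich1978, §1 (p. 1184)] -/
theorem n0_mem_koblitzList_or_of_exists_isIsogeny_pow_elliptic_finite {r s : ZMod n} (hr : r ≠ 0) (hs : s ≠ 0)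
    (hrs : r.val + s.val < n)
    {hS : ∀ c : ZMod n, c.val.Coprime n → (c ∈ fermatCMType n r s (-(r + s)) ↔ -c ∉ fermatCMType n r s (-(r + s)))}
    {A : AbelianVariety ℂ} {ι : 𝓞 L →+* End A} {θ : L →+* Module.End ℂ (complexBetti A.X 1)}
    (hA : IsCMTypeRealisation (cmTypeOfResidues (L := L) (fermatCMType n r s (-(r + s))) hS) A ι θ)
    (hE : ∃ (E P : AbelianVariety ℂ) (h : ℕ) (π : Fin h → (P ⟶ E)) (g : A ⟶ P),
      E.dim = 1 ∧ Nonempty (IsLimit (Fan.mk P π)) ∧ IsIsogeny g) :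
    n / Nat.gcd (Nat.gcd r.val s.val) n ∈ ({3, 4, 6, 7, 8, 12, 15, 16, 18, 20, 21, 22, 24, 30, 39, 40, 48, 60} : Finset ℕ) ∨
      (72 < n / Nat.gcd (Nat.gcd r.val s.val) n ∧ n / Nat.gcd (Nat.gcd r.val s.val) n ≤ (2 ^ 65) ^ (2 ^ 65)) := by
  have hrv : 0 < r.val := Nat.pos_of_ne_zero fun h => hr ((ZMod.val_eq_zero r).1 h)
  have hsv : 0 < s.val := Nat.pos_of_ne_zero fun h => hs ((ZMod.val_eq_zero s).1 h)
  have hn2 : 2 < n := by omega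
  haveI : IsCMField L := IsCyclotomicExtension.Rat.isCMField L (S := {n}) ⟨n, rfl, hn2⟩
  have hcl := (exists_isIsogeny_pow_elliptic_fermat_iff_forall_mul_mem hn2 (one_mem_fermatCMType_of_val_add_lt hr hrs) hA).1 hE
  exact n0_mem_koblitzList_or_of_forall_mul_mem_finite n hr hs hrs hcl

end AllLevels

end CyclotomicFermatCMType

end Literature.AlgebraicGeometry.ComplexMultiplication
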